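import Mathlib.Analysis.Complex.AbsMax
import Mathlib.Analysis.Complex.Liouville
import Mathlib.Analysis.Complex.RemovableSingularity
import Literature.MathematicalPhysics.QuantumFieldTheory.Balaban1983to89.B7Prop3GeneralTild
import Literature.MathematicalPhysics.QuantumFieldTheory.Balaban1983to89.B7Prop3GeneralAnalytic

/-!
# `Balaban1983to89.B7Eq112General` — T. Bałaban, *Averaging operations for lattice gauge theories*, Commun. Math. Phys.
**98** (1985) 17–51 [Balaban1985Averaging]: the second-order ESTIMATES of the one-step expansion (110)–(120) AT A GENERAL
REGULAR BACKGROUND `V₀` — (111), (112) and (118) with their `O(|A|²)` remainders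

statement-level skeleton of published theorems with citation tags; proofs where landed; nothing here is a claim about the Yang–Mills mass gap

PDF held: `paper:balaban1985-cmp98-averaging` (journal page = PDF page + 16); pp. 34–36 [PDF 18–20] read on the renders
`b2b-balaban-ref1/pages/1985-cmp98-averaging/1985-cmp98-averaging-p018-x2.png`, `-p019-x2.png`, `-p020-x2.png` (AS IMAGES).

CITATION HEADER / WHAT IS REPRODUCED.  SKELETON row **B7.Eq110** ((110)–(120) pp. 34–35; its first-order / derivative content
at a general background is `B7Prop3GeneralRotated` (111), `B7Prop3GeneralLinear` (112), `B7Prop3GeneralTild` (113)–(119),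
`linQcov_eq` (120); its second-order ESTIMATES were proved only at `V₀ = 1`, `B7Prop3Flat.frame_estimate`/`dbavg_estimate`);
cell `lit-balaban` (HOME `run/shared/lean/pub/lit-balaban/`), seat p06 gen 2 = unit `lit-balaban-p06`.  p. 34, verbatim:
*"\overline{R_{0,y}V₁} = exp[i Σ_{x∈B(y)} L^{−d}(1/i) log(R_{0,y}V₁)(Γ_{y,x})], y ∈ Ω′^{(1)}. (110) We have (1/i) log(R_{0,y}V₁)
(Γ_{y,x}) = (R_{0,y}A)(Γ_{y,x}) + O((|A|(Γ_{y,x}))²), (111) hence \overline{R_{0,y}V₁} = exp[i Σ_{x∈B(y)} L^{−d}(R_{0,y}A)(Γ_{y,x})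
+ O(L²α₁²)]. (112)"*; p. 35: *"= exp[(Q′(V₀)A)_c + O(L²α₁²)], (118)"* for `(Ṽ₁)_c` ((113), (117)); *"(V̿₁)_c = (\overline{R_{0,c₋}V₁})⁻¹
(Ṽ₁)_c R̄_{0,c}\overline{R_{0,c₊}V₁} = exp[−i Σ_{x∈B(c₋)} L^{−d}(R_{0,c₋}A)(Γ_{c₋,x}) + i(Q′(V₀)A)_c + i Σ_{x′∈B(c₊)} L^{−d} R̄_{0,c}
(R_{0,c₊}A)(Γ_{c₊,x′}) + O(L²α₁²)]. (120)"* (under (109) «|V₀(∂p) − 1| < α₀, V_{1,b} = e^{iA_b}, |A_b| < α₁»).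

CARRIERS (REUSED BY NAME): `B7Eq92Concrete.tHol` ((58) `(R_{0,y}V₁)(Γ)`), `.Fcov`/`.wframe` ((110)), `.tild` ((113) `Ṽ₁`);
`B7Prop3GeneralRotated.tsum` (`(R_{0,y}A)(Γ)`), `B7Prop3GeneralLinear.FhatCov` (the exponent of (112)), `B7Prop3GeneralTild.QprimeCov`
(`(Q′(V₀)A)_c`, (119)); `B7Prop3Flat.expCfg`, `.c3`.  INPUTS BY NAME: the derivatives `hasDerivAt_mlog_tHol_expCfg` ((111)),
`hasDerivAt_Fcov_expCfg` ((112)), `hasDerivAt_tild_expCfg` ((113)–(119)); analyticity and domain bounds of `B7Prop3GeneralAnalytic`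
(`analyticAt_tHol_expCfg`, `analyticAt_Fcov_expCfg`, `analyticAt_tild_expCfg`, `norm_tHol_expCfg_sub_one_le_of_length`,
`norm_Fcov_le_of_tHol`, `logDomainCov`, `tild_eq_exp_tHol_exp`, `norm_Xavg_le_of_Wcx`).

WHAT THIS FILE PROVES (kernel, 0 sorry, theorems only), for `V₀` unit-bounded, `V₁ = e^{A}` with `sup_b|A_b| ≤ a ≤ c₃(d,L) =
1/(128(d+1)L)` — by the route of (123) (`B7Eq123General`): each quantity, read along the complex ray `t ↦ ·(tA)`, vanishes at
`t = 0`, is analytic and bounded on the disc `|t| ≤ c₃/a ⊇ {|t| ≤ 1}`, and a (private) second-order Cauchy estimate bounds the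
remainder after the first-order term:
* **`eq111_general`** = (111): `|(1/i) log(R_{0,y}V₁)(Γ) − (R_{0,y}A)(Γ)| ≤ 2048(d+1)²L²·a²` for every contour word of length
  `≤ (2d+2)L` (the tree contours `Γ_{y,x}`, the loops `Γ_{c,x} ∪ (−c)` of (114)/(115), the segment `c`);
* **`eq112_general`** = (112): `|F(y) − F̂(y)| ≤ 2048(d+1)²L²·a²` — the exponent of the block frame minus its first-order term;
* **`eq118_general`** = (118): at an `L`-bond whose block loops are `α`-regular (`α ≤ 1/64`), `|(1/i) log Ṽ₁(c) − (Q′(V₀)A)_c| ≤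
  24576(d+1)²L²·a²`; with `norm_tild_sub_one_le` (`|Ṽ₁(c) − 1| ≤ 3/8` on the disc) as the log-domain input.
(120)'s remainder is `B7Eq123General.norm_Ccov_le` ((123)).  Print's `O(L²α₁²)` / `O((|A||Γ|)²)` constants are thus EXPLICIT and
depend on `d` only (with `|Γ| ≤ (2d+2)L` absorbed into `L²`).  DIVERGENCES: `<` ↦ `≤`; global sup bounds on `ℤᵈ`.
-/

noncomputable section

open scoped BigOperators
open NormedSpace Metric Set Finset

namespace Literature.MathematicalPhysics.QuantumFieldTheory.Balaban1983to89.B7Eq112General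

open B7Prop1Explicit B7Prop2Explicit B7Prop3Flat B7Eq92Concrete MatrixLog B7Prop3GeneralRotated B7Prop3GeneralAnalytic
  B7Prop3GeneralLinear B7Prop3GeneralTild
open B7Eq78Linearization (hasDerivAt_mlog_comp)

-- `Site` alone would resolve to the torus sites of `Setup.lean`; re-export the `ℤ^d` sites of `B7Prop1Explicit`.
export B7Prop1Explicit (Site)

/-! ## §0 [folklore] The second-order Cauchy estimate at the centre of a disc (private copy of `B7Eq123General` §1) -/

section Cauchy

variable {F : Type*} [NormedAddCommGroup F] [NormedSpace ℂ F] [CompleteSpace F]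

/-- Second-order Cauchy estimate at the centre of a disc: `g` complex-differentiable on `|t| ≤ R`, `g 0 = 0`, `‖g‖ ≤ M` on
`|t| = R` ⟹ `‖g t − t·g′(0)‖ ≤ (2M/R²)|t|²` for `|t| ≤ R` (removable singularities + Cauchy's estimate + maximum modulus;
`private`: a generic helper, not a statement of the source). [folklore] -/
private theorem norm_sub_smul_deriv_le_of_sphere {g : ℂ → F} {R M : ℝ} (hR : 0 < R)
    (hg : DifferentiableOn ℂ g (closedBall 0 R)) (hM : ∀ z ∈ sphere (0 : ℂ) R, ‖g z‖ ≤ M) (h0 : g 0 = 0)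
    {t : ℂ} (ht : ‖t‖ ≤ R) : ‖g t - t • deriv g 0‖ ≤ 2 * M / R ^ 2 * ‖t‖ ^ 2 := by
  have hcl : closure (ball (0 : ℂ) R) = closedBall 0 R := closure_ball 0 hR.ne'
  have hfr : frontier (ball (0 : ℂ) R) = sphere 0 R := frontier_ball 0 hR.ne'
  have hnhds : closedBall (0 : ℂ) R ∈ nhds (0 : ℂ) := closedBall_mem_nhds 0 hR
  set φ : ℂ → F := dslope g 0 with hφ
  set ψ : ℂ → F := dslope φ 0 with hψ
  have hφd : DifferentiableOn ℂ φ (closedBall 0 R) := (Complex.differentiableOn_dslope hnhds).2 hg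
  have hψd : DifferentiableOn ℂ ψ (closedBall 0 R) := (Complex.differentiableOn_dslope hnhds).2 hφd
  have hφ_eq : ∀ s : ℂ, s • φ s = g s := fun s => by
    have := sub_smul_dslope g 0 s
    rwa [sub_zero, h0, sub_zero] at this
  have hψ_eq : ∀ s : ℂ, s • ψ s = φ s - deriv g 0 := fun s => by
    have := sub_smul_dslope φ 0 s
    rwa [sub_zero, hφ, dslope_same] at this
  have hgc : DiffContOnCl ℂ g (ball 0 R) := DifferentiableOn.diffContOnCl (by rw [hcl]; exact hg)
  have hψc : DiffContOnCl ℂ ψ (ball 0 R) := DifferentiableOn.diffContOnCl (by rw [hcl]; exact hψd)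
  have hg' : ‖deriv g 0‖ ≤ M / R := Complex.norm_deriv_le_of_forall_mem_sphere_norm_le hR hgc hM
  have hψS : ∀ z ∈ sphere (0 : ℂ) R, ‖ψ z‖ ≤ 2 * M / R ^ 2 := by
    intro z hz
    have hzR : ‖z‖ = R := mem_sphere_zero_iff_norm.1 hz
    have h1 : R * ‖φ z‖ ≤ M := by
      have := congrArg (‖·‖) (hφ_eq z)
      simp only [norm_smul, hzR] at this
      rw [this]; exact hM z hz
    have h2 : R * ‖ψ z‖ ≤ M / R + M / R := by
      have := congrArg (‖·‖) (hψ_eq z)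
      simp only [norm_smul, hzR] at this
      rw [this]
      refine (norm_sub_le _ _).trans (add_le_add ?_ hg')
      rw [le_div_iff₀ hR]; linarith
    rw [le_div_iff₀ (by positivity)]
    have : R * (R * ‖ψ z‖) ≤ R * (M / R + M / R) := mul_le_mul_of_nonneg_left h2 hR.le
    have hRR : R * (M / R + M / R) = 2 * M := by field_simp; ring
    nlinarith
  have hψt : ‖ψ t‖ ≤ 2 * M / R ^ 2 :=
    Complex.norm_le_of_forall_mem_frontier_norm_le isBounded_ball hψc (by rw [hfr]; exact hψS)
      (by rw [hcl]; exact mem_closedBall_zero_iff.2 ht)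
  have hrem : g t - t • deriv g 0 = t • (t • ψ t) := by
    rw [hψ_eq t, smul_sub, hφ_eq t]
  rw [hrem, norm_smul, norm_smul]
  have ht0 : 0 ≤ ‖t‖ := norm_nonneg t
  calc ‖t‖ * (‖t‖ * ‖ψ t‖) ≤ ‖t‖ * (‖t‖ * (2 * M / R ^ 2)) := by gcongr
    _ = 2 * M / R ^ 2 * ‖t‖ ^ 2 := by ring

/-- … specialised to the form used below: with `R = c/a ≥ 1` (`0 < a ≤ c`), the remainder at `t = 1` is `≤ 2M·(a/c)²`. [folklore] -/
private theorem norm_sub_deriv_le_ray {g : ℂ → F} {a c M : ℝ} (ha : 0 < a) (hac : a ≤ c)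
    (hg : ∀ t : ℂ, ‖t‖ * a ≤ c → DifferentiableAt ℂ g t) (hM : ∀ t : ℂ, ‖t‖ * a ≤ c → ‖g t‖ ≤ M) (h0 : g 0 = 0) :
    ‖g 1 - deriv g 0‖ ≤ 2 * M * (a / c) ^ 2 := by
  set R : ℝ := c / a with hR
  have hR1 : 1 ≤ R := by rw [hR, le_div_iff₀ ha]; linarith
  have hR0 : 0 < R := by linarith
  have hdisc : ∀ t : ℂ, ‖t‖ ≤ R → ‖t‖ * a ≤ c := fun t ht => by rw [hR, le_div_iff₀ ha] at ht; exact ht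
  have hDiff : DifferentiableOn ℂ g (closedBall 0 R) := fun t ht =>
    (hg t (hdisc t (mem_closedBall_zero_iff.1 ht))).differentiableWithinAt
  have h := norm_sub_smul_deriv_le_of_sphere hR0 hDiff (fun t ht => hM t (hdisc t (mem_sphere_zero_iff_norm.1 ht).le)) h0
    (t := 1) (by rw [norm_one]; exact hR1)
  rw [norm_one, one_pow, mul_one, one_smul] at h
  refine h.trans (le_of_eq ?_)
  have hc : c ≠ 0 := (ha.trans_le hac).ne'
  rw [hR, div_pow, div_pow]
  field_simp

end Cauchy

variable {d : ℕ}
variable {𝔸 : Type*} [NormedRing 𝔸] [NormedAlgebra ℂ 𝔸] [CompleteSpace 𝔸] [NormOneClass 𝔸]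

/-! ## §1 Elementary pieces: the disc `|t|·a ≤ c₃`, the degenerate field, small products -/

/-- print's threshold in the `θ`-currency of `B7Prop3GeneralAnalytic`: `|t|·a ≤ c₃(d, L)` gives `(2d+2)L·(|t|a) ≤ 1/64`
(private arithmetic helper). [cite: Balaban1985Averaging, Proposition 3 p.36] -/
private theorem theta_le_of_le_c3 {L : ℕ} (hL : 1 ≤ L) {a : ℝ} (hac : a ≤ c3 d L) :
    ((2 * (d * L) + L + L : ℕ) : ℝ) * a ≤ 1 / 64 := by
  have hL1 : (1 : ℝ) ≤ L := by exact_mod_cast hL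
  have hcast : ((2 * (d * L) + L + L : ℕ) : ℝ) = 2 * ((d : ℝ) + 1) * L := by push_cast; ring
  rw [hcast]
  have hpos : (0 : ℝ) < 128 * ((d : ℝ) + 1) * L := by positivity
  have h1 : a * (128 * ((d : ℝ) + 1) * L) ≤ 1 := by
    have := mul_le_mul_of_nonneg_right hac hpos.le
    rwa [c3, one_div, inv_mul_cancel₀ hpos.ne'] at this
  nlinarith

/-- `(a/c₃)² = 16384(d+1)²L²·a²` (private arithmetic helper). [cite: Balaban1985Averaging, Proposition 3 p.36] -/
private theorem sq_div_c3 {L : ℕ} (hL : 1 ≤ L) (a : ℝ) :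
    (a / c3 d L) ^ 2 = 16384 * ((d : ℝ) + 1) ^ 2 * (L : ℝ) ^ 2 * a ^ 2 := by
  have hL0 : (0 : ℝ) < L := by exact_mod_cast hL
  have hpos : (0 : ℝ) < 128 * ((d : ℝ) + 1) * L := by positivity
  rw [c3]
  field_simp
  ring

omit [NormedAlgebra ℂ 𝔸] [CompleteSpace 𝔸] [NormOneClass 𝔸] in
/-- `‖XY − 1‖ ≤ x + y + xy` (private normed-ring bookkeeping). [folklore] -/
private theorem norm_mul_sub_one_le {X Y : 𝔸} {x y : ℝ} (hX : ‖X - 1‖ ≤ x) (hY : ‖Y - 1‖ ≤ y) (hx : 0 ≤ x) :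
    ‖X * Y - 1‖ ≤ x + y + x * y := by
  have h : X * Y - 1 = (X - 1) * (Y - 1) + (X - 1) + (Y - 1) := by noncomm_ring
  rw [h]
  calc ‖(X - 1) * (Y - 1) + (X - 1) + (Y - 1)‖ ≤ ‖(X - 1) * (Y - 1)‖ + ‖X - 1‖ + ‖Y - 1‖ := norm_add₃_le
    _ ≤ ‖X - 1‖ * ‖Y - 1‖ + ‖X - 1‖ + ‖Y - 1‖ := by gcongr; exact norm_mul_le _ _
    _ ≤ x * y + x + y := by gcongr
    _ = x + y + x * y := by ring

omit [NormOneClass 𝔸] in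
/-- `‖e^{Y} − 1‖ ≤ 2‖Y‖` for `‖Y‖ ≤ 1` (private). [folklore] -/
private theorem norm_exp_sub_one_le_two_mul {Y : 𝔸} (h : ‖Y‖ ≤ 1) : ‖exp Y - 1‖ ≤ 2 * ‖Y‖ := by
  have h1 := (norm_exp_sub_one_le_of_norm_le (le_refl ‖Y‖)).1
  have h2 := Real.abs_exp_sub_one_le (x := ‖Y‖) (by rwa [abs_of_nonneg (norm_nonneg _)])
  rw [abs_of_nonneg (norm_nonneg Y)] at h2
  exact h1.trans ((le_abs_self _).trans h2)

variable {L : ℕ} {V₀ : Site d → Fin d → 𝔸ˣ} {A : Site d → Fin d → 𝔸} {a : ℝ}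

omit [CompleteSpace 𝔸] [NormOneClass 𝔸] in
/-- the bond bound along the ray: `|(tA)_b| ≤ |t|·a` (private). [folklore] -/
private theorem norm_smul_cfg_le (hA : ∀ x κ, ‖A x κ‖ ≤ a) (t : ℂ) : ∀ x κ, ‖(t • A) x κ‖ ≤ ‖t‖ * a :=
  fun x κ => by rw [Pi.smul_apply, Pi.smul_apply, norm_smul]; exact mul_le_mul_of_nonneg_left (hA x κ) (norm_nonneg _)

omit [NormedAlgebra ℂ 𝔸] [CompleteSpace 𝔸] [NormOneClass 𝔸] in
/-- the degenerate field: `sup|A_b| ≤ 0` forces `A = 0` (private). [folklore] -/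
private theorem cfg_eq_zero_of_le_zero (hA : ∀ x κ, ‖A x κ‖ ≤ a) (h0 : a = 0) : A = 0 := by
  funext x κ
  have := hA x κ
  rw [h0] at this
  exact norm_le_zero_iff.1 this

/-! ## §2 (111) at a general background -/

/-- **(111) AT A GENERAL BACKGROUND** — *"(1/i) log(R_{0,y}V₁)(Γ_{y,x}) = (R_{0,y}A)(Γ_{y,x}) + O((|A|(Γ_{y,x}))²), (111)"*: for
`V₀` unit-bounded, `V₁ = e^{A}` with `sup_b|A_b| ≤ a ≤ c₃(d,L)`, and every contour word `Γ` of length `≤ (2d+2)L` (the tree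
contours `Γ_{y,x}`, the loops `Γ_{c,x} ∪ (−c)` of (114)–(115), the segment `c`): `|log (R_{0,y}e^{A})(Γ) − (R_{0,y}A)(Γ)| ≤
2048(d+1)²L²·a²`, `(R_{0,y}A)(Γ)` = `B7Prop3GeneralRotated.tsum` being the first-order term (`hasDerivAt_mlog_tHol_expCfg`).  Along
the ray the twisted holonomy is within `1/32` of `1` (`norm_tHol_expCfg_sub_one_le_of_length`), so its logarithm is analytic with
`|·| ≤ 1/16`; §0. [cite: Balaban1985Averaging, (111) p.34] -/
theorem eq111_general (hL : 1 ≤ L) (hV₀ : ∀ x κ, V₀ x κ ∈ U1 𝔸) (ha : 0 ≤ a) (hA : ∀ x κ, ‖A x κ‖ ≤ a)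
    (hac : a ≤ c3 d L) (y : Site d) {w : List (Letter d)} (hw : w.length ≤ 2 * (d * L) + L + L) :
    ‖mlog ((tHol V₀ (expCfg A) y w : 𝔸ˣ) : 𝔸) - tsum V₀ A y w‖ ≤ 2048 * ((d : ℝ) + 1) ^ 2 * (L : ℝ) ^ 2 * a ^ 2 := by
  rcases ha.eq_or_lt with h0 | hpos
  · -- the degenerate field `A = 0`: both terms vanish
    have hA0 := cfg_eq_zero_of_le_zero hA h0.symm
    subst hA0
    have h1 : mlog ((tHol V₀ (expCfg (0 : Site d → Fin d → 𝔸)) y w : 𝔸ˣ) : 𝔸) = 0 := by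
      have := tHol_expCfg_zero_smul V₀ (0 : Site d → Fin d → 𝔸) y w
      rw [smul_zero] at this
      rw [this, Units.val_one, mlog_one]
    have h2 : tsum V₀ (0 : Site d → Fin d → 𝔸) y w = 0 := by
      have h := tsum_smul V₀ (0 : ℂ) (0 : Site d → Fin d → 𝔸) y w
      rwa [zero_smul, zero_smul] at h
    rw [h1, h2, sub_zero, norm_zero]; positivity
  set g : ℂ → 𝔸 := fun t : ℂ => mlog ((tHol V₀ (expCfg (t • A)) y w : 𝔸ˣ) : 𝔸) with hg
  -- along the ray the holonomy is within `1/32` of `1`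
  have hT : ∀ t : ℂ, ‖t‖ * a ≤ c3 d L → ‖((tHol V₀ (expCfg (t • A)) y w : 𝔸ˣ) : 𝔸) - 1‖ ≤ 1 / 32 := fun t ht => by
    have := norm_tHol_expCfg_sub_one_le_of_length hV₀ (t • A) (by positivity) (norm_smul_cfg_le hA t)
      (theta_le_of_le_c3 hL ht) (by norm_num) le_rfl hw y
    linarith
  have hDiff : ∀ t : ℂ, ‖t‖ * a ≤ c3 d L → DifferentiableAt ℂ g t := fun t ht =>
    ((ExpMeanLog.analyticAt_mlog ((hT t ht).trans_lt (by norm_num))).fun_comp_of_eq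
      (analyticAt_tHol_expCfg (fun t : ℂ => t • A)
        (fun x κ => by simp only [Pi.smul_apply]; exact analyticAt_id.smul analyticAt_const) V₀ y w).1 rfl).differentiableAt
  have hM : ∀ t : ℂ, ‖t‖ * a ≤ c3 d L → ‖g t‖ ≤ 1 / 16 := fun t ht =>
    (norm_mlog_le_two_mul ((hT t ht).trans (by norm_num))).trans (by linarith [hT t ht])
  have h0 : g 0 = 0 := by
    simp only [hg]
    rw [tHol_expCfg_zero_smul, Units.val_one, mlog_one]
  have h := norm_sub_deriv_le_ray hpos hac hDiff hM h0
  have hg1 : g 1 = mlog ((tHol V₀ (expCfg A) y w : 𝔸ˣ) : 𝔸) := by simp only [hg, one_smul]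
  have hgd : deriv g 0 = tsum V₀ A y w := (hasDerivAt_mlog_tHol_expCfg V₀ A y w).deriv
  rw [hg1, hgd] at h
  refine h.trans (le_of_eq ?_)
  rw [sq_div_c3 hL]; ring

/-! ## §3 (112) at a general background -/

/-- **(112) AT A GENERAL BACKGROUND** — *"hence \overline{R_{0,y}V₁} = exp[i Σ_{x∈B(y)} L^{−d}(R_{0,y}A)(Γ_{y,x}) + O(L²α₁²)]. (112)"*:
for `V₀` unit-bounded and `V₁ = e^{A}` with `sup_b|A_b| ≤ a ≤ c₃(d,L)`, the exponent `F(y)` of the block frame (110)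
(`\overline{R_{0,y}V₁} = exp F(y)`, `B7Eq92Concrete.wframe`/`Fcov`) differs from its first-order term `F̂(y) = Σ_{x∈B(y)} L^{−d}
(R_{0,y}A)(Γ_{y,x})` (`B7Prop3GeneralLinear.FhatCov`, `hasDerivAt_Fcov_expCfg`) by `|F(y) − F̂(y)| ≤ 2048(d+1)²L²·a²`.  Along the
ray every tree holonomy is within `1/32` of `1`, so `F` is analytic (`analyticAt_Fcov_expCfg`) with `|F| ≤ 1/16`
(`norm_Fcov_le_of_tHol`); `F(0) = 0`; §0. [cite: Balaban1985Averaging, (112) p.34] -/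
theorem eq112_general (hL : 1 ≤ L) (hV₀ : ∀ x κ, V₀ x κ ∈ U1 𝔸) (ha : 0 ≤ a) (hA : ∀ x κ, ‖A x κ‖ ≤ a)
    (hac : a ≤ c3 d L) (y : Site d) :
    ‖Fcov L V₀ (expCfg A) y - FhatCov L V₀ A y‖ ≤ 2048 * ((d : ℝ) + 1) ^ 2 * (L : ℝ) ^ 2 * a ^ 2 := by
  rcases ha.eq_or_lt with h0 | hpos
  · have hA0 := cfg_eq_zero_of_le_zero hA h0.symm
    subst hA0
    have h1 : Fcov L V₀ (expCfg (0 : Site d → Fin d → 𝔸)) y = 0 := by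
      have := Fcov_expCfg_zero_smul L V₀ (0 : Site d → Fin d → 𝔸) y
      rwa [smul_zero] at this
    have h2 : FhatCov L V₀ (0 : Site d → Fin d → 𝔸) y = 0 := by
      have := FhatCov_smul L V₀ (0 : ℂ) (0 : Site d → Fin d → 𝔸) y
      rwa [zero_smul, zero_smul] at this
    rw [h1, h2, sub_zero, norm_zero]; positivity
  set g : ℂ → 𝔸 := fun t : ℂ => Fcov L V₀ (expCfg (t • A)) y with hg
  have htree : ∀ r : Fin d → Fin L, (treeWord (boxVec L r)).length ≤ 2 * (d * L) + L + L := fun r => by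
    rw [length_treeWord]; have := l1_boxVec_le (L := L) r; omega
  have hT : ∀ t : ℂ, ‖t‖ * a ≤ c3 d L → ∀ r : Fin d → Fin L,
      ‖((tHol V₀ (expCfg (t • A)) y (treeWord (boxVec L r)) : 𝔸ˣ) : 𝔸) - 1‖ ≤ 1 / 32 := fun t ht r => by
    have := norm_tHol_expCfg_sub_one_le_of_length hV₀ (t • A) (by positivity) (norm_smul_cfg_le hA t)
      (theta_le_of_le_c3 hL ht) (by norm_num) le_rfl (htree r) y
    linarith
  have hDiff : ∀ t : ℂ, ‖t‖ * a ≤ c3 d L → DifferentiableAt ℂ g t := fun t ht =>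
    (analyticAt_Fcov_expCfg (fun t : ℂ => t • A)
      (fun x κ => by simp only [Pi.smul_apply]; exact analyticAt_id.smul analyticAt_const) L V₀ y
      (fun r => (hT t ht r).trans_lt (by norm_num))).differentiableAt
  have hM : ∀ t : ℂ, ‖t‖ * a ≤ c3 d L → ‖g t‖ ≤ 1 / 16 := fun t ht => by
    have := norm_Fcov_le_of_tHol hL V₀ (expCfg (t • A)) y (hT t ht) (by norm_num)
    simp only [hg]; linarith
  have h0 : g 0 = 0 := by simp only [hg]; exact Fcov_expCfg_zero_smul L V₀ A y
  have h := norm_sub_deriv_le_ray hpos hac hDiff hM h0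
  have hg1 : g 1 = Fcov L V₀ (expCfg A) y := by simp only [hg, one_smul]
  have hgd : deriv g 0 = FhatCov L V₀ A y := (hasDerivAt_Fcov_expCfg L V₀ A y).deriv
  rw [hg1, hgd] at h
  refine h.trans (le_of_eq ?_)
  rw [sq_div_c3 hL]; ring

/-! ## §4 (118) at a general background -/

/-- **`|Ṽ₁(c) − 1| ≤ 3/8` on the disc** (the size that makes `(1/i) log Ṽ₁(c)` in (117)–(118) meaningful): for `V₀` unit-bounded
with `α`-regular block loops at `c` (`α ≤ 1/64`) and `V₁ = e^{A}` with `(2d+2)L·sup_b|A_b| ≤ 1/64`, by (113)/(65) rearranged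
`Ṽ₁(c) = e^{X_c(V₁V₀)}·(R_{0,c₋}V₁)(Γ_c)·e^{−X_c(V₀)}` (`tild_eq_exp_tHol_exp`) with `|X_c(V₁V₀)| ≤ 1/8`, `|(R_{0,c₋}V₁)(Γ_c) − 1| ≤
1/32`, `|X_c(V₀)| ≤ 1/32` (the bookkeeping of `B7Prop3GeneralAnalytic.logDomainCov`). [cite: Balaban1985Averaging, (113) p.34, (117)–(118) p.35] -/
theorem norm_tild_sub_one_le (hL : 1 ≤ L) (hV₀ : ∀ x κ, V₀ x κ ∈ U1 𝔸) (A' : Site d → Fin d → 𝔸) {a' α : ℝ}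
    (ha : 0 ≤ a') (hA : ∀ x κ, ‖A' x κ‖ ≤ a') (hθ : ((2 * (d * L) + L + L : ℕ) : ℝ) * a' ≤ 1 / 64)
    (q : Site d) (κ : Fin d) (hα1 : α ≤ 1 / 64)
    (hreg : ∀ r : Fin d → Fin L, ‖((Wcx L V₀ q κ (boxVec L r) : 𝔸ˣ) : 𝔸) - 1‖ ≤ α) :
    ‖((tild L V₀ (expCfg A') q κ : 𝔸ˣ) : 𝔸) - 1‖ ≤ 3 / 8 := by
  obtain ⟨hW, -, -, -⟩ := logDomainCov hL hV₀ A' ha hA hθ (by norm_num) le_rfl q κ hα1 hreg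
  have hseg : (seg κ (L : ℤ) : List (Letter d)).length ≤ 2 * (d * L) + L + L := by
    rw [length_seg, Int.natAbs_natCast]; omega
  have hτ : ‖((tHol V₀ (expCfg A') q (seg κ L) : 𝔸ˣ) : 𝔸) - 1‖ ≤ 1 / 32 := by
    have := norm_tHol_expCfg_sub_one_le_of_length hV₀ A' ha hA hθ (by norm_num) le_rfl hseg q
    linarith
  have hX' : ‖Xavg L (expCfg A' * V₀) q κ‖ ≤ 1 / 8 :=
    (norm_Xavg_le_of_Wcx hL _ q κ hW (by norm_num)).trans (by norm_num)
  have hX₀ : ‖Xavg L V₀ q κ‖ ≤ 1 / 32 := (norm_Xavg_le_of_Wcx hL _ q κ hreg (by linarith)).trans (by linarith)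
  have hE' : ‖exp (Xavg L (expCfg A' * V₀) q κ) - 1‖ ≤ 1 / 4 :=
    (norm_exp_sub_one_le_two_mul (hX'.trans (by norm_num))).trans (by linarith)
  have hE₀' : ‖exp (-Xavg L V₀ q κ) - 1‖ ≤ 1 / 16 :=
    (norm_exp_sub_one_le_two_mul ((norm_neg _).le.trans (hX₀.trans (by norm_num)))).trans
      (by rw [norm_neg]; linarith)
  rw [tild_eq_exp_tHol_exp, Units.val_mul, Units.val_mul, val_expUnit, val_expUnit]
  have h1 := norm_mul_sub_one_le hE' hτ (by norm_num)
  refine (norm_mul_sub_one_le h1 hE₀' (by norm_num)).trans ?_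
  norm_num

/-- **(118) AT A GENERAL BACKGROUND** — *"(Ṽ₁)_c = … = exp[(Q′(V₀)A)_c + O(L²α₁²)], (118)"*: for `V₀` unit-bounded with
`α`-regular block loops at the `L`-bond `c = (q, κ)` (`α ≤ 1/64`; (109) via Prop. 1) and `V₁ = e^{A}` with `sup_b|A_b| ≤ a ≤
c₃(d,L)`: `|(1/i) log Ṽ₁(c) − (Q′(V₀)A)_c| ≤ 24576(d+1)²L²·a²`, `(Q′(V₀)A)_c` = `B7Prop3GeneralTild.QprimeCov` ((119); the
`t`-derivative of `Ṽ₁(c)[e^{tA}]` at `0`, `hasDerivAt_tild_expCfg`).  Along the ray `|Ṽ₁(c) − 1| ≤ 3/8`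
(`norm_tild_sub_one_le`), so `log Ṽ₁(c)` is analytic (`analyticAt_tild_expCfg` + the series (21)) with `|·| ≤ 3/4`; §0.
[cite: Balaban1985Averaging, (118) p.35, (113) p.34] -/
theorem eq118_general (hL : 1 ≤ L) (hV₀ : ∀ x κ, V₀ x κ ∈ U1 𝔸) (ha : 0 ≤ a) (hA : ∀ x κ, ‖A x κ‖ ≤ a)
    (hac : a ≤ c3 d L) (q : Site d) (κ : Fin d) {α : ℝ} (hα1 : α ≤ 1 / 64)
    (hreg : ∀ r : Fin d → Fin L, ‖((Wcx L V₀ q κ (boxVec L r) : 𝔸ˣ) : 𝔸) - 1‖ ≤ α) :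
    ‖mlog ((tild L V₀ (expCfg A) q κ : 𝔸ˣ) : 𝔸) - QprimeCov L V₀ A q κ‖
      ≤ 24576 * ((d : ℝ) + 1) ^ 2 * (L : ℝ) ^ 2 * a ^ 2 := by
  have hWlt : ∀ r : Fin d → Fin L, ‖((Wcx L V₀ q κ (boxVec L r) : 𝔸ˣ) : 𝔸) - 1‖ < 1 :=
    fun r => ((hreg r).trans hα1).trans_lt (by norm_num)
  rcases ha.eq_or_lt with h0 | hpos
  · have hA0 := cfg_eq_zero_of_le_zero hA h0.symm
    subst hA0
    have h1 : mlog ((tild L V₀ (expCfg (0 : Site d → Fin d → 𝔸)) q κ : 𝔸ˣ) : 𝔸) = 0 := by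
      rw [expCfg_zero, tild_one_right, Units.val_one, mlog_one]
    have h2 : QprimeCov L V₀ (0 : Site d → Fin d → 𝔸) q κ = 0 := by
      have := QprimeCov_smul L V₀ (0 : ℂ) (0 : Site d → Fin d → 𝔸) q κ
      rwa [zero_smul, zero_smul] at this
    rw [h1, h2, sub_zero, norm_zero]; positivity
  set g : ℂ → 𝔸 := fun t : ℂ => mlog ((tild L V₀ (expCfg (t • A)) q κ : 𝔸ˣ) : 𝔸) with hg
  have htl : ∀ t : ℂ, ‖t‖ * a ≤ c3 d L → ‖((tild L V₀ (expCfg (t • A)) q κ : 𝔸ˣ) : 𝔸) - 1‖ ≤ 3 / 8 := fun t ht =>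
    norm_tild_sub_one_le hL hV₀ (t • A) (by positivity) (norm_smul_cfg_le hA t) (theta_le_of_le_c3 hL ht) q κ hα1 hreg
  have hW : ∀ t : ℂ, ‖t‖ * a ≤ c3 d L →
      ∀ r : Fin d → Fin L, ‖((Wcx L (expCfg (t • A) * V₀) q κ (boxVec L r) : 𝔸ˣ) : 𝔸) - 1‖ < 1 := fun t ht r =>
    ((logDomainCov hL hV₀ (t • A) (by positivity) (norm_smul_cfg_le hA t) (theta_le_of_le_c3 hL ht) (by norm_num) le_rfl
      q κ hα1 hreg).1 r).trans_lt (by norm_num)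
  have hDiff : ∀ t : ℂ, ‖t‖ * a ≤ c3 d L → DifferentiableAt ℂ g t := fun t ht =>
    ((ExpMeanLog.analyticAt_mlog ((htl t ht).trans_lt (by norm_num))).fun_comp_of_eq
      (analyticAt_tild_expCfg (fun t : ℂ => t • A)
        (fun x κ' => by simp only [Pi.smul_apply]; exact analyticAt_id.smul analyticAt_const) L V₀ q κ (hW t ht))
      rfl).differentiableAt
  have hM : ∀ t : ℂ, ‖t‖ * a ≤ c3 d L → ‖g t‖ ≤ 3 / 4 := fun t ht =>
    (norm_mlog_le_two_mul ((htl t ht).trans (by norm_num))).trans (by linarith [htl t ht])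
  have h0 : g 0 = 0 := by
    simp only [hg]
    rw [zero_smul, expCfg_zero, tild_one_right, Units.val_one, mlog_one]
  have h := norm_sub_deriv_le_ray hpos hac hDiff hM h0
  have hg1 : g 1 = mlog ((tild L V₀ (expCfg A) q κ : 𝔸ˣ) : 𝔸) := by simp only [hg, one_smul]
  have hgd : deriv g 0 = QprimeCov L V₀ A q κ :=
    (hasDerivAt_mlog_comp (by rw [zero_smul, expCfg_zero, tild_one_right, Units.val_one])
      (hasDerivAt_tild_expCfg L V₀ A q κ hWlt)).deriv
  rw [hg1, hgd] at h
  refine h.trans (le_of_eq ?_)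
  rw [sq_div_c3 hL]; ring

end Literature.MathematicalPhysics.QuantumFieldTheory.Balaban1983to89.B7Eq112General

end
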